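import Summits.BirchSwinnertonDyer.Rank1Residual.X9.PartitionF2
import Summits.BirchSwinnertonDyer.Rank1Residual.GoodSupersingularRow
import Literature.NumberTheory.EllipticCurves.Rank1Residual.X9ImageShape
import Literature.NumberTheory.EllipticCurves.SupersingularIrreducibleProofs
import HarnessLib

/-!
# The strong partial theorem: `BSD(E,p)` outside the named corners (cell `b2b-bsdres`,
# RESIDUAL-MAP.md §A/§B/§C CORNER PREDICATES; coordinator ruling 2026-08-20T22:24Z)

HONEST FRAMING (run/shared/lean/b2b/bsd-rank1-residual/, verbatim in every file): the goal of the
cell is to DELETE the COMBINATION-SHAPED residual classes of the Birch–Swinnerton-Dyer formula for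
ALL analytic-rank `≤ 1` elliptic curves over `ℚ` — "full BSD formula for every rank `≤ 1` curve in
class `C`" assembled STRICTLY from published theorems — so that the rank-`≤ 1` remainder becomes
exactly the CONSTRUCTION-SHAPED classes, which are TYPED (missing-input `Prop`s), NOT attempted.
This is not "finishing BSD". Nothing here is a Literature statement; NO named fact is introduced;
every theorem below is an assembly of `Partition/Bsdp.lean`'s covered-row bindings
(`RowC1.bsdp`, `RowC3.bsdp`, `RowC16.bsdp`, `bsdp_or_residual` via
`X9/PartitionF2.lean`'s `bsdp_or_residualV3_or_classX11b`) with the elementary exclusivity of the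
reduction types; the PUB\* flags of rows C2 (`BCS25-IMC-equiv@BSTW`), C3-ss (`JSW-ss`) and C16
(`YZ26@3-BF-ERL-Ohta`) travel with the named facts `hBCS`, `hJSW`, `hYZ` exactly as in
`Partition/Bsdp.lean`.

THE STATEMENT (coordinator ruling relayed 2026-08-20T22:24Z, recorded by the director in
RESIDUAL-MAP.md §I: "BSD_p for every `E/ℚ` of analytic rank `≤ 1` at every odd prime `p` of good
reduction (and multiplicative when `r = 0`) outside NAMED corners, kernel-verified"). For a globally
minimal non-CM elliptic `W/ℚ` with `r := analyticRank W ≤ 1` and an odd prime `p` such that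
EITHER `p` is good OR (`p` is multiplicative and `r = 0`), `BSDp W p` holds — granted the fourteen
named published facts of the covered rows — UNLESS `(W, p)` lies in one of the NAMED CORNERS
(RESIDUAL-MAP.md §A/§B/§C corner predicates, rmap-1 gen 2, 2026-08-20T22:30Z/22:37Z; kernel class
predicates of `Literature/…/Rank1Residual/Predicates.lean` and `Partition/Rows.lean`):
* good ORDINARY axis (§A): `ClassX1 W p` (Eisenstein ANOMALOUS: `red ∧ anom ∧ ¬(r = 0 ∧ gvpar)`),
  `ClassX9 W p` (small irreducible image `5Ns/5S4/7Ns`, `p ∈ {5, 7}` only by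
  `ClassX9.eq_five_or_eq_seven`), `ClassX10 W p ∧ ¬ Surj W p` (= X10b, `p = 3`, image `3Ns/3Nn`;
  the tree's `ClassX10` also contains the surjective pairs off the S–U/JSW floor, which row C16
  covers, hence the conjunct `¬ Surj`);
* good SUPERSINGULAR axis (§B): `ClassX6 W p ∧ r = 0` (Kobayashi's signed main conjecture —
  announced BSTW, PRE), `ClassX7 W p` (non-semistable), `ClassX8 W p` (`p = 3`, `a_3 = ±3`); the
  only covered supersingular cell is `r = 1 ∧ semistable ∧ (p ≥ 5 ∨ a_3 = 0)` (JSW Thm 1.2.1,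
  PUB\* `JSW-ss`);
* MULTIPLICATIVE axis, `r = 0` (§C): `ClassX11a W p` (no second multiplicative prime at which
  `E[p]` ramifies — '(ram) fails', e.g. every prime conductor `N = p`; NOT an image condition) and
  `ClassX2 W p` (`E[p]` reducible).
The rank-one multiplicative axis (X11b, X2c), the additive axis (X3/X4), `p = 2` (X5) and the CM
bad-prime corner (X12) are outside the statement by its wording (RESIDUAL-MAP §I complement).

Specialisations: on the good ordinary axis at `p ≥ 11` the corner is X1 ALONE (X9 needs
`p ∈ {5,7}` — the published Balakrishnan–Dogra–Müller–Tuitman–Vonk 2019 Thm 1.2 enters as the named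
fact `hBDMTV` of `ClassX9.eq_five_or_eq_seven` — and X10b needs `p = 3`), and by Greenberg, LNM 1716
p. 136 / Greenberg–Vatsal 2000 a non-CM rational `p`-isogeny at a good `p ≥ 11` forces
`p ∈ {13, 37}` (not used in the kernel: `ClassX1` is kept as the hypothesis); the supersingular and
multiplicative clauses need three facts each, not fourteen.

References: RESIDUAL-MAP.md §A/§B/§C (CORNER PREDICATE paragraphs), §I (HEADLINE DELIVERABLE);
HOME/PARTITION.md §3; `Partition/Bsdp.lean`; `X9/PartitionF2.lean`.
-/

namespace Summit.BirchSwinnertonDyer.Rank1Residual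

open WeierstrassCurve Literature.NumberTheory.EllipticCurves
  Literature.NumberTheory.EllipticCurves.Rank1Residual Literature.NumberTheory.EllipticCurves.ModularForms
open scoped NumberField

section Curve

variable {W : WeierstrassCurve ℚ} [W.IsElliptic] [W.IsGloballyMinimal] {p : ℕ} [Fact p.Prime]

/-! ### Elementary inputs -/

/-- An odd prime is at least `3`. [folklore] -/
theorem three_le_of_ne_two (hp : p ≠ 2) : 3 ≤ p := by
  have h2 := (Fact.out : p.Prime).two_le
  omega

/-- **The covered supersingular cell is row C3**: at an odd prime of good supersingular reduction,
a semistable rank-one curve with `p ≥ 5 ∨ a_3 = 0` satisfies the hypotheses of Jetchev–Skinner–Wan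
2017 Thm 1.2.1 as the tree states them (`RowC3`): `E[p]` is irreducible by Serre 1972 §1.11
Prop. 12 (tree `hasIrreducibleModPGaloisRep_of_dvd_frobeniusTrace`), and `p ≥ 5 ∨ a_3 = 0` with
`p` odd gives JSW's `p ≥ 5 ∨ (p = 3 ∧ a_3 = 0)`. [folklore] -/
theorem rowC3_of_goodSS_rankOne (hp : p ≠ 2) (hss : GoodSS W p) (hsst : Semistable W)
    (hr1 : W.analyticRank = 1) (h5 : 5 ≤ p ∨ W.frobeniusTrace 3 = 0) : RowC3 W p := by
  have hirr : Irr W p :=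
    hasIrreducibleModPGaloisRep_of_dvd_frobeniusTrace W p hp
      (W.not_dvd_minimalDiscriminantInt_of_hasGoodReductionAtPrime' p hss.1) hss.2
  refine ⟨hr1, hsst, hss.1, hirr, ?_⟩
  rcases h5 with h5 | ha3
  · exact Or.inl h5
  · by_cases hp3 : p = 3
    · exact Or.inr ⟨hp3, Or.inr ha3⟩
    · exact Or.inl (five_le_of_prime_of_ne p hp hp3)

/-! ### The assembled statement -/

/-- **STRONG PARTIAL THEOREM (good primes, and multiplicative primes in rank `0`, outside the named
corners).** Granted the fourteen named published facts behind the covered rows (exactly the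
hypotheses of `bsdp_or_residual`; PUB\* flags travel with `hBCS`, `hJSW`, `hYZ`): for `W/ℚ`
globally minimal elliptic, NON-CM, of analytic rank `r ≤ 1`, and an ODD prime `p` with `p` good, or
`p` multiplicative and `r = 0`, Miller's `BSD(E,p)` holds unless `(W, p)` lies in one of the eight
named corners X1, X9, X10b, X6 ∧ `r = 0`, X7, X8, X11a, X2 (RESIDUAL-MAP.md §A/§B/§C corner
predicates). Proof: `bsdp_or_residualV3_or_classX11b` leaves `BSDp` or one of X1–X12 or X11b; the
corners are excluded by hypothesis; X3/X4 need an additive `p`, X5 needs `p = 2`, X12 needs CM, X11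
and X11b need a multiplicative `p` (then `r = 0` and either X11a or a rank-one clause), X6 with
`r = 1` is row C3 (`rowC3_of_goodSS_rankOne`), and the surjective part of the tree's X10 is row C16.
[folklore] -/
theorem bsdp_of_not_corner (hSk : Skinner2016.thmC_padicValRat_bsd_rank_zero)
    (hBCS : BurungaleCastellaSkinner2025.cor131_padicValRat_bsd_rank_le_one)
    (hJSW : JetchevSkinnerWan2017.thm121_padicValRat_bsd_rank_one)
    (hCGS : CastellaGrossiSkinner2025.thmD_padicValRat_bsd_rank_le_one)
    (hGV : GreenbergVatsal2000.thm13_charIdeal_eq_of_gvPar) (hGr : greenberg_charValue_rankZero)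
    (hmod : hasEntireLFunction_rat) (hmodP : nonempty_modularParametrizationData)
    (hGZK : rank_eq_analyticRank_of_analyticRank_le_one)
    (hCM : bsdTriple_of_hasCM_of_L_one_ne_zero) (hKob : Kobayashi2013.cor14_bsdp_of_cm_rank_one)
    (hYZ : YanZhu2026.thm415_padicValRat_bsd_rank_le_one)
    (hW20 : Wuthrich2014.lemma20_surjective_threeAdic_of_semistable)
    (hLLT : LiLiuTian2024.thm11_bsdp_of_cm_rank_one)
    (hr : W.analyticRank ≤ 1) (hcm : ¬ W.HasCM) (hp : p ≠ 2)
    (hdom : Good W p ∨ (Mult W p ∧ W.analyticRank = 0))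
    (hX1 : ¬ ClassX1 W p) (hX9 : ¬ ClassX9 W p) (hX10b : ¬ (ClassX10 W p ∧ ¬ Surj W p))
    (hX6 : ¬ (ClassX6 W p ∧ W.analyticRank = 0)) (hX7 : ¬ ClassX7 W p) (hX8 : ¬ ClassX8 W p)
    (hX11a : ¬ ClassX11a W p) (hX2 : ¬ ClassX2 W p) : BSDp W p := by
  have hngm : Good W p → ¬ Mult W p := fun hg ↦ not_mult_of_good W p hg
  rcases bsdp_or_residualV3_or_classX11b (W := W) (p := p) hSk hBCS hJSW hCGS hGV hGr hmod hmodP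
      hGZK hCM hKob hYZ hW20 hLLT hr with h | hres | hx11b
  · exact h
  · rcases hres with h1 | h2 | h3 | h4 | h5 | h6 | h7 | h8 | h9 | h10 | h11 | h12
    · exact absurd h1 hX1
    · exact absurd h2 hX2
    · -- X3: additive
      rcases hdom with hg | ⟨hm, -⟩
      · exact absurd hg h3.2.1
      · exact absurd hm h3.2.2
    · -- X4: additive
      rcases hdom with hg | ⟨hm, -⟩
      · exact absurd hg h4.2.1.1
      · exact absurd hm h4.2.1.2
    · -- X5: p = 2
      exact absurd h5 hp
    · -- X6: supersingular semistable; rank 0 is the corner, rank 1 is row C3 (JSW, PUB* `JSW-ss`)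
      have hrk : W.analyticRank = 0 ∨ W.analyticRank = 1 := by omega
      rcases hrk with hr0 | hr1
      · exact absurd ⟨h6, hr0⟩ hX6
      · exact RowC3.bsdp hJSW hmod hGZK (rowC3_of_goodSS_rankOne hp h6.1 h6.2.1 hr1 h6.2.2)
    · exact absurd h7 hX7
    · exact absurd h8 hX8
    · exact absurd h9 hX9
    · -- X10 (tree): its surjective part is row C16 (Yan–Zhu, PUB* `YZ26@3`), the rest is the corner X10b
      by_cases hs : Surj W p
      · obtain ⟨hp3, hord, hirr, -⟩ := h10
        subst hp3
        exact RowC16.bsdp hYZ hW20 hmod hGZK hr ⟨rfl, hord, hirr, Or.inl hs⟩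
      · exact absurd ⟨h10, hs⟩ hX10b
    · -- X11 (tree): multiplicative; in rank 0 the only live clause is ¬(ram) = X11a
      rcases hdom with hg | ⟨hm, hr0⟩
      · exact absurd h11.1 (hngm hg)
      · rcases h11.2.2 with hnr | ⟨hr1, -⟩ | ⟨hr1, -⟩
        · exact absurd ⟨hr0, hp, hm, h11.2.1, hnr⟩ hX11a
        · omega
        · omega
    · exact absurd h12.1 hcm
  · -- X11b: rank-one multiplicative — outside the domain
    rcases hdom with hg | ⟨-, hr0⟩
    · exact absurd hx11b.2.2.1 (hngm hg)
    · have := hx11b.1; omega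

/-- **Good primes (both kinds), corner form**: for non-CM `W` of analytic rank `≤ 1` and an odd
prime `p` of GOOD reduction, `BSD(E,p)` unless one of the six good-prime corners X1, X9, X10b
(ordinary) or X6 ∧ `r = 0`, X7, X8 (supersingular) — the multiplicative corners are vacuous at a
good prime (`not_mult_of_good`). [folklore] -/
theorem bsdp_good_of_not_corner (hSk : Skinner2016.thmC_padicValRat_bsd_rank_zero)
    (hBCS : BurungaleCastellaSkinner2025.cor131_padicValRat_bsd_rank_le_one)
    (hJSW : JetchevSkinnerWan2017.thm121_padicValRat_bsd_rank_one)
    (hCGS : CastellaGrossiSkinner2025.thmD_padicValRat_bsd_rank_le_one)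
    (hGV : GreenbergVatsal2000.thm13_charIdeal_eq_of_gvPar) (hGr : greenberg_charValue_rankZero)
    (hmod : hasEntireLFunction_rat) (hmodP : nonempty_modularParametrizationData)
    (hGZK : rank_eq_analyticRank_of_analyticRank_le_one)
    (hCM : bsdTriple_of_hasCM_of_L_one_ne_zero) (hKob : Kobayashi2013.cor14_bsdp_of_cm_rank_one)
    (hYZ : YanZhu2026.thm415_padicValRat_bsd_rank_le_one)
    (hW20 : Wuthrich2014.lemma20_surjective_threeAdic_of_semistable)
    (hLLT : LiLiuTian2024.thm11_bsdp_of_cm_rank_one)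
    (hr : W.analyticRank ≤ 1) (hcm : ¬ W.HasCM) (hp : p ≠ 2) (hgood : Good W p)
    (hX1 : ¬ ClassX1 W p) (hX9 : ¬ ClassX9 W p) (hX10b : ¬ (ClassX10 W p ∧ ¬ Surj W p))
    (hX6 : ¬ (ClassX6 W p ∧ W.analyticRank = 0)) (hX7 : ¬ ClassX7 W p) (hX8 : ¬ ClassX8 W p) :
    BSDp W p :=
  bsdp_of_not_corner hSk hBCS hJSW hCGS hGV hGr hmod hmodP hGZK hCM hKob hYZ hW20 hLLT hr hcm hp
    (Or.inl hgood) hX1 hX9 hX10b hX6 hX7 hX8 (fun h11a ↦ not_mult_of_good W p hgood h11a.2.2.1)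
    (fun h2 ↦ not_mult_of_good W p hgood h2.2.2)

/-! ### The three axes separately -/

/-- **Good ORDINARY axis (RESIDUAL-MAP §A corner predicate).** For non-CM `W` of analytic rank
`≤ 1` and an odd good ordinary `p`: `BSD(E,p)` unless X1 (Eisenstein anomalous), X9 (image
`5Ns/5S4/7Ns` at `p ∈ {5,7}`) or X10b (`p = 3`, image `3Ns/3Nn`). The supersingular and
multiplicative corners are vacuous here (`GoodOrd` excludes `GoodSS` and `Mult`). [folklore] -/
theorem bsdp_goodOrd_of_not_corner (hSk : Skinner2016.thmC_padicValRat_bsd_rank_zero)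
    (hBCS : BurungaleCastellaSkinner2025.cor131_padicValRat_bsd_rank_le_one)
    (hJSW : JetchevSkinnerWan2017.thm121_padicValRat_bsd_rank_one)
    (hCGS : CastellaGrossiSkinner2025.thmD_padicValRat_bsd_rank_le_one)
    (hGV : GreenbergVatsal2000.thm13_charIdeal_eq_of_gvPar) (hGr : greenberg_charValue_rankZero)
    (hmod : hasEntireLFunction_rat) (hmodP : nonempty_modularParametrizationData)
    (hGZK : rank_eq_analyticRank_of_analyticRank_le_one)
    (hCM : bsdTriple_of_hasCM_of_L_one_ne_zero) (hKob : Kobayashi2013.cor14_bsdp_of_cm_rank_one)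
    (hYZ : YanZhu2026.thm415_padicValRat_bsd_rank_le_one)
    (hW20 : Wuthrich2014.lemma20_surjective_threeAdic_of_semistable)
    (hLLT : LiLiuTian2024.thm11_bsdp_of_cm_rank_one)
    (hr : W.analyticRank ≤ 1) (hcm : ¬ W.HasCM) (hp : p ≠ 2) (hgo : GoodOrd W p)
    (hX1 : ¬ ClassX1 W p) (hX9 : ¬ ClassX9 W p) (hX10b : ¬ (ClassX10 W p ∧ ¬ Surj W p)) :
    BSDp W p :=
  bsdp_of_not_corner hSk hBCS hJSW hCGS hGV hGr hmod hmodP hGZK hCM hKob hYZ hW20 hLLT hr hcm hp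
    (Or.inl hgo.1) hX1 hX9 hX10b (fun ⟨h6, _⟩ ↦ hgo.2 h6.1.2) (fun h7 ↦ hgo.2 h7.1.2)
    (fun h8 ↦ by obtain ⟨rfl, hss, -⟩ := h8; exact hgo.2 hss.2)
    (fun h11a ↦ not_mult_of_good W p hgo.1 h11a.2.2.1) (fun h2 ↦ not_mult_of_good W p hgo.1 h2.2.2)

/-- **Good ordinary axis at `p ≥ 11`: the corner is X1 alone.** X9 lives at `p ∈ {5, 7}`
(`ClassX9.eq_five_or_eq_seven`, conditional exactly on the published Balakrishnan–Dogra–Müller–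
Tuitman–Vonk 2019 Thm 1.2, the named fact `hBDMTV`) and X10b at `p = 3`. So for every non-CM
`E/ℚ` of analytic rank `≤ 1` and every good ordinary prime `p ≥ 11`, `BSD(E,p)` is an assembly of
published theorems unless `E` admits a rational `p`-isogeny with anomalous kernel character outside
the `r = 0 ∧ GV-parity` quadrant (`ClassX1`; by Greenberg LNM 1716 p. 136 this needs
`p ∈ {13, 37}`). [folklore] -/
theorem bsdp_goodOrd_of_eleven_le (hSk : Skinner2016.thmC_padicValRat_bsd_rank_zero)
    (hBCS : BurungaleCastellaSkinner2025.cor131_padicValRat_bsd_rank_le_one)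
    (hJSW : JetchevSkinnerWan2017.thm121_padicValRat_bsd_rank_one)
    (hCGS : CastellaGrossiSkinner2025.thmD_padicValRat_bsd_rank_le_one)
    (hGV : GreenbergVatsal2000.thm13_charIdeal_eq_of_gvPar) (hGr : greenberg_charValue_rankZero)
    (hmod : hasEntireLFunction_rat) (hmodP : nonempty_modularParametrizationData)
    (hGZK : rank_eq_analyticRank_of_analyticRank_le_one)
    (hCM : bsdTriple_of_hasCM_of_L_one_ne_zero) (hKob : Kobayashi2013.cor14_bsdp_of_cm_rank_one)
    (hYZ : YanZhu2026.thm415_padicValRat_bsd_rank_le_one)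
    (hW20 : Wuthrich2014.lemma20_surjective_threeAdic_of_semistable)
    (hLLT : LiLiuTian2024.thm11_bsdp_of_cm_rank_one)
    (hBDMTV : BalakrishnanEtAl2019.thm12_not_le_normalizer_splitCartan)
    (hr : W.analyticRank ≤ 1) (hcm : ¬ W.HasCM) (hgo : GoodOrd W p) (h11 : 11 ≤ p)
    (hX1 : ¬ ClassX1 W p) : BSDp W p :=
  bsdp_goodOrd_of_not_corner hSk hBCS hJSW hCGS hGV hGr hmod hmodP hGZK hCM hKob hYZ hW20 hLLT hr
    hcm (by omega) hgo hX1
    (fun h9 ↦ by rcases ClassX9.eq_five_or_eq_seven hBDMTV W p h9 with h | h <;> omega)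
    (fun ⟨h10, _⟩ ↦ by have := h10.1; omega)

/-- **Good SUPERSINGULAR axis (RESIDUAL-MAP §B corner predicate): the covered cell.** At an odd
good supersingular `p`, a semistable curve of analytic rank one with `p ≥ 5 ∨ a_3 = 0` satisfies
`BSD(E,p)` by Jetchev–Skinner–Wan 2017 Thm 1.2.1 (named fact `hJSW`; PUB\* flag `JSW-ss` in this
sub-case) — three facts, not fourteen. Everything else on this axis (all of rank `0`; non-semistable;
`p = 3` with `a_3 = ±3`) is the corner X6 ∧ `r = 0` / X7 / X8. [folklore] -/
theorem bsdp_goodSS_rankOne_semistable (hJSW : JetchevSkinnerWan2017.thm121_padicValRat_bsd_rank_one)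
    (hmod : hasEntireLFunction_rat) (hGZK : rank_eq_analyticRank_of_analyticRank_le_one)
    (hp : p ≠ 2) (hss : GoodSS W p) (hsst : Semistable W) (hr1 : W.analyticRank = 1)
    (h5 : 5 ≤ p ∨ W.frobeniusTrace 3 = 0) : BSDp W p :=
  RowC3.bsdp hJSW hmod hGZK (rowC3_of_goodSS_rankOne hp hss hsst hr1 h5)

/-- **MULTIPLICATIVE axis, rank `0` (RESIDUAL-MAP §C corner predicate): the covered cell is row C1.**
At an odd multiplicative `p`, a curve of analytic rank `0` with `E[p]` irreducible and a (ram)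
witness satisfies `BSD(E,p)` by Skinner 2016 Thm C (named fact `hSk`) — three facts. The rank-`0`
corners are exactly '(ram) fails' (X11a) and '`E[p]` reducible' (X2). [folklore] -/
theorem bsdp_mult_rankZero_of_irr_of_ram (hSk : Skinner2016.thmC_padicValRat_bsd_rank_zero)
    (hmod : hasEntireLFunction_rat) (hGZK : rank_eq_analyticRank_of_analyticRank_le_one)
    (hp : p ≠ 2) (hm : Mult W p) (hr0 : W.analyticRank = 0) (hirr : Irr W p) (hram : Ram W p) :
    BSDp W p :=
  RowC1.bsdp hSk hmod hGZK ⟨hr0, three_le_of_ne_two hp, Or.inr hm, hirr, hram⟩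

/-- **Multiplicative axis, rank `0`, corner form**: outside X11a and X2, a rank-`0` pair at an odd
multiplicative prime is in row C1. [folklore] -/
theorem bsdp_mult_rankZero_of_not_corner (hSk : Skinner2016.thmC_padicValRat_bsd_rank_zero)
    (hmod : hasEntireLFunction_rat) (hGZK : rank_eq_analyticRank_of_analyticRank_le_one)
    (hp : p ≠ 2) (hm : Mult W p) (hr0 : W.analyticRank = 0)
    (hX11a : ¬ ClassX11a W p) (hX2 : ¬ ClassX2 W p) : BSDp W p := by
  by_cases hirr : Irr W p
  · by_cases hram : Ram W p
    · exact bsdp_mult_rankZero_of_irr_of_ram hSk hmod hGZK hp hm hr0 hirr hram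
    · exact absurd ⟨hr0, hp, hm, hirr, hram⟩ hX11a
  · exact absurd ⟨hp, hirr, hm⟩ hX2

/-! ### All curves: the CM case needs no corner at a good or multiplicative odd prime
(appended, rmap-1 gen 2) -/

/-- **CM curves at an odd good prime, or at a multiplicative prime in rank `0`, are covered
outright**: rank `0` by Rubin 1991 / Burungale–Flach 2024 (row C8, every `p`; named fact `hCM`),
rank `1` at a good odd `p` by Kobayashi 2013 Cor. 1.4 (row C10; named fact `hKob`, PUB[sec] flag
`KOB13-primary-unread` travels with it); a CM curve is never multiplicative, so the multiplicative
clause is vacuous for it (here it is simply excluded by the rank). The CM corner X12 of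
RESIDUAL-MAP §F lives at the BAD non-split primes and at `p = 2`, outside this domain. [folklore] -/
theorem bsdp_cm_of_good_or_mult_rankZero (hCM : bsdTriple_of_hasCM_of_L_one_ne_zero)
    (hKob : Kobayashi2013.cor14_bsdp_of_cm_rank_one) (hmod : hasEntireLFunction_rat)
    (hr : W.analyticRank ≤ 1) (hcm : W.HasCM) (hp : p ≠ 2)
    (hdom : Good W p ∨ (Mult W p ∧ W.analyticRank = 0)) : BSDp W p := by
  have hrk : W.analyticRank = 0 ∨ W.analyticRank = 1 := by omega
  rcases hrk with hr0 | hr1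
  · exact RowC8.bsdp hCM hmod ⟨hcm, hr0⟩
  · rcases hdom with hg | ⟨-, hr0⟩
    · exact RowC10.bsdp hKob ⟨hcm, hr1, hp, hg⟩
    · omega

/-- **STRONG PARTIAL THEOREM, every `E/ℚ` (CM included).** For `W/ℚ` globally minimal elliptic of
analytic rank `r ≤ 1` and an ODD prime `p` with `p` good, or `p` multiplicative and `r = 0`:
granted the fourteen named published facts of the covered rows, `BSD(E,p)` holds unless `(W, p)`
lies in one of the eight named NON-CM corners X1, X9, X10b, X6 ∧ `r = 0`, X7, X8, X11a, X2
(RESIDUAL-MAP §A/§B/§C); a CM curve meets no corner here (`bsdp_cm_of_good_or_mult_rankZero`).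
The coordinator's wording (2026-08-20T22:24Z) — 'BSD_p for every E/ℚ of analytic rank ≤ 1 at every
odd prime p of good reduction (and multiplicative when r = 0) outside NAMED corners' — as one
kernel statement. [folklore] -/
theorem bsdp_of_not_corner' (hSk : Skinner2016.thmC_padicValRat_bsd_rank_zero)
    (hBCS : BurungaleCastellaSkinner2025.cor131_padicValRat_bsd_rank_le_one)
    (hJSW : JetchevSkinnerWan2017.thm121_padicValRat_bsd_rank_one)
    (hCGS : CastellaGrossiSkinner2025.thmD_padicValRat_bsd_rank_le_one)
    (hGV : GreenbergVatsal2000.thm13_charIdeal_eq_of_gvPar) (hGr : greenberg_charValue_rankZero)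
    (hmod : hasEntireLFunction_rat) (hmodP : nonempty_modularParametrizationData)
    (hGZK : rank_eq_analyticRank_of_analyticRank_le_one)
    (hCM : bsdTriple_of_hasCM_of_L_one_ne_zero) (hKob : Kobayashi2013.cor14_bsdp_of_cm_rank_one)
    (hYZ : YanZhu2026.thm415_padicValRat_bsd_rank_le_one)
    (hW20 : Wuthrich2014.lemma20_surjective_threeAdic_of_semistable)
    (hLLT : LiLiuTian2024.thm11_bsdp_of_cm_rank_one)
    (hr : W.analyticRank ≤ 1) (hp : p ≠ 2)
    (hdom : Good W p ∨ (Mult W p ∧ W.analyticRank = 0))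
    (hX1 : ¬ ClassX1 W p) (hX9 : ¬ ClassX9 W p) (hX10b : ¬ (ClassX10 W p ∧ ¬ Surj W p))
    (hX6 : ¬ (ClassX6 W p ∧ W.analyticRank = 0)) (hX7 : ¬ ClassX7 W p) (hX8 : ¬ ClassX8 W p)
    (hX11a : ¬ ClassX11a W p) (hX2 : ¬ ClassX2 W p) : BSDp W p := by
  by_cases hcm : W.HasCM
  · exact bsdp_cm_of_good_or_mult_rankZero hCM hKob hmod hr hcm hp hdom
  · exact bsdp_of_not_corner hSk hBCS hJSW hCGS hGV hGr hmod hmodP hGZK hCM hKob hYZ hW20 hLLT hr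
      hcm hp hdom hX1 hX9 hX10b hX6 hX7 hX8 hX11a hX2

/-- **Every `E/ℚ`, good ordinary `p ≥ 11`: the only corner is X1** (CM included: a CM curve at a
good ordinary `p` is covered by rows C8/C10). [folklore] -/
theorem bsdp_goodOrd_of_eleven_le' (hSk : Skinner2016.thmC_padicValRat_bsd_rank_zero)
    (hBCS : BurungaleCastellaSkinner2025.cor131_padicValRat_bsd_rank_le_one)
    (hJSW : JetchevSkinnerWan2017.thm121_padicValRat_bsd_rank_one)
    (hCGS : CastellaGrossiSkinner2025.thmD_padicValRat_bsd_rank_le_one)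
    (hGV : GreenbergVatsal2000.thm13_charIdeal_eq_of_gvPar) (hGr : greenberg_charValue_rankZero)
    (hmod : hasEntireLFunction_rat) (hmodP : nonempty_modularParametrizationData)
    (hGZK : rank_eq_analyticRank_of_analyticRank_le_one)
    (hCM : bsdTriple_of_hasCM_of_L_one_ne_zero) (hKob : Kobayashi2013.cor14_bsdp_of_cm_rank_one)
    (hYZ : YanZhu2026.thm415_padicValRat_bsd_rank_le_one)
    (hW20 : Wuthrich2014.lemma20_surjective_threeAdic_of_semistable)
    (hLLT : LiLiuTian2024.thm11_bsdp_of_cm_rank_one)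
    (hBDMTV : BalakrishnanEtAl2019.thm12_not_le_normalizer_splitCartan)
    (hr : W.analyticRank ≤ 1) (hgo : GoodOrd W p) (h11 : 11 ≤ p) (hX1 : ¬ ClassX1 W p) :
    BSDp W p := by
  by_cases hcm : W.HasCM
  · exact bsdp_cm_of_good_or_mult_rankZero hCM hKob hmod hr hcm (by omega) (Or.inl hgo.1)
  · exact bsdp_goodOrd_of_eleven_le hSk hBCS hJSW hCGS hGV hGr hmod hmodP hGZK hCM hKob hYZ hW20
      hLLT hBDMTV hr hcm hgo h11 hX1

/-! ### Large primes: the two quotable forms at `p ≥ 11` (appended, rmap-1 gen 2) -/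

/-- **Every `E/ℚ` of analytic rank `≤ 1`, every good ORDINARY `p ≥ 11` with `E[p]` irreducible:
`BSD(E,p)`** (granted the fourteen named published facts + BDMTV 2019; PUB\* flag `BCS25` on the
non-(ram)/non-semistable part travels with `hBCS`). The corner X1 needs `E[p]` reducible, so it is
absent here; X9 needs `p ∈ {5, 7}`, X10b needs `p = 3`. [folklore] -/
theorem bsdp_goodOrd_of_irr_of_eleven_le (hSk : Skinner2016.thmC_padicValRat_bsd_rank_zero)
    (hBCS : BurungaleCastellaSkinner2025.cor131_padicValRat_bsd_rank_le_one)
    (hJSW : JetchevSkinnerWan2017.thm121_padicValRat_bsd_rank_one)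
    (hCGS : CastellaGrossiSkinner2025.thmD_padicValRat_bsd_rank_le_one)
    (hGV : GreenbergVatsal2000.thm13_charIdeal_eq_of_gvPar) (hGr : greenberg_charValue_rankZero)
    (hmod : hasEntireLFunction_rat) (hmodP : nonempty_modularParametrizationData)
    (hGZK : rank_eq_analyticRank_of_analyticRank_le_one)
    (hCM : bsdTriple_of_hasCM_of_L_one_ne_zero) (hKob : Kobayashi2013.cor14_bsdp_of_cm_rank_one)
    (hYZ : YanZhu2026.thm415_padicValRat_bsd_rank_le_one)
    (hW20 : Wuthrich2014.lemma20_surjective_threeAdic_of_semistable)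
    (hLLT : LiLiuTian2024.thm11_bsdp_of_cm_rank_one)
    (hBDMTV : BalakrishnanEtAl2019.thm12_not_le_normalizer_splitCartan)
    (hr : W.analyticRank ≤ 1) (hgo : GoodOrd W p) (h11 : 11 ≤ p) (hirr : Irr W p) : BSDp W p :=
  bsdp_goodOrd_of_eleven_le' hSk hBCS hJSW hCGS hGV hGr hmod hmodP hGZK hCM hKob hYZ hW20 hLLT hBDMTV
    hr hgo h11 (fun h1 ↦ h1.2.1 hirr)

/-- **Every `E/ℚ` of analytic rank `≤ 1`, every GOOD prime `p ≥ 11` (ordinary or supersingular):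
`BSD(E,p)` unless X1 (a rational `p`-isogeny with anomalous kernel character outside the
`r = 0 ∧ GV-parity` quadrant — possible only at `p ∈ {13, 37}`) or the supersingular rank-`0` /
non-semistable corner (X6 ∧ `r = 0`, X7; X8 needs `p = 3`, X9 needs `p ∈ {5,7}`, X10b `p = 3`).**
The supersingular hypothesis is stated positively: at a supersingular `p` we ask `r = 1` and `E`
semistable (then row C3, PUB\* `JSW-ss`). [folklore] -/
theorem bsdp_good_of_eleven_le (hSk : Skinner2016.thmC_padicValRat_bsd_rank_zero)
    (hBCS : BurungaleCastellaSkinner2025.cor131_padicValRat_bsd_rank_le_one)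
    (hJSW : JetchevSkinnerWan2017.thm121_padicValRat_bsd_rank_one)
    (hCGS : CastellaGrossiSkinner2025.thmD_padicValRat_bsd_rank_le_one)
    (hGV : GreenbergVatsal2000.thm13_charIdeal_eq_of_gvPar) (hGr : greenberg_charValue_rankZero)
    (hmod : hasEntireLFunction_rat) (hmodP : nonempty_modularParametrizationData)
    (hGZK : rank_eq_analyticRank_of_analyticRank_le_one)
    (hCM : bsdTriple_of_hasCM_of_L_one_ne_zero) (hKob : Kobayashi2013.cor14_bsdp_of_cm_rank_one)
    (hYZ : YanZhu2026.thm415_padicValRat_bsd_rank_le_one)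
    (hW20 : Wuthrich2014.lemma20_surjective_threeAdic_of_semistable)
    (hLLT : LiLiuTian2024.thm11_bsdp_of_cm_rank_one)
    (hBDMTV : BalakrishnanEtAl2019.thm12_not_le_normalizer_splitCartan)
    (hr : W.analyticRank ≤ 1) (hgood : Good W p) (h11 : 11 ≤ p) (hX1 : ¬ ClassX1 W p)
    (hSS : GoodSS W p → W.analyticRank = 1 ∧ Semistable W) : BSDp W p :=
  bsdp_of_not_corner' hSk hBCS hJSW hCGS hGV hGr hmod hmodP hGZK hCM hKob hYZ hW20 hLLT hr (by omega)
    (Or.inl hgood) hX1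
    (fun h9 ↦ by rcases ClassX9.eq_five_or_eq_seven hBDMTV W p h9 with h | h <;> omega)
    (fun ⟨h10, _⟩ ↦ by have := h10.1; omega)
    (fun ⟨h6, hr0⟩ ↦ by have := (hSS h6.1).1; omega) (fun h7 ↦ h7.2 (hSS h7.1).2)
    (fun h8 ↦ by have := h8.1; omega)
    (fun h11a ↦ not_mult_of_good W p hgood h11a.2.2.1) (fun h2 ↦ not_mult_of_good W p hgood h2.2.2)

end Curve

end Summit.BirchSwinnertonDyer.Rank1Residual
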